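import Literature.Topology.FourManifolds.HCobordismWhitneyTrickProofs
import Literature.Topology.FourManifolds.WhitneyModelSheets
import Literature.Topology.FourManifolds.WhitneyDiscCollarCore
import Literature.Topology.FourManifolds.WhitneyDiscCore
import Literature.Topology.FourManifolds.WhitneyDiscFrames
import Literature.Topology.FourManifolds.WhitneyThickening
import Literature.Topology.FourManifolds.WhitneySignCondition
import Literature.Topology.FourManifolds.ComplementaryFrameAlongArc
import Literature.Topology.FourManifolds.FramedArcThroughTwoPoints
import Mathlib.Geometry.Manifold.WhitneyEmbedding
import HarnessLib

/-!
# Milnor 1965, Theorem 6.6 (the Whitney trick): discharge of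
# `Literature.Topology.FourManifolds.Milnor1965_whitney_isotopy`

Topic `Literature/Topology/FourManifolds` (fact seat
`provefact-Literature.Topology.FourManifolds.Milnor1965_whitney_isotopy`).  Milnor, *Lectures
on the h-cobordism theorem* (1965), **Theorem 6.6** with its Remark (PDF pp. 39–45): two
transverse intersection points `p`, `q` of opposite sign of `M^r`, `M'^s ⊂ V^{r+s}`
(`r ≥ 2`, `s ≥ 3`, `V` simply connected, and `V ∖ M'` simply connected if `r = 2`) are removed
by an ambient isotopy of `V` fixed near the other intersection points.

The tree reduces the theorem (`WhitneyModelSheets.lean`,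
`Literature.Topology.FourManifolds.Milnor1965_whitney_isotopy_of_sheetModels`: Lemma 6.7 in
sheet form suffices, the standard-model isotopy Lemma 6.8 being done there) to the construction
of the **thickened Whitney disc** `Θ : (ℝ × ℝ) × (F₁ × F₂) → V` of Lemma 6.7: a local
diffeomorphism along the model disc `D̄`, injective on `D̄`, carrying the model sheets
`{(x, x² - 1)} × F₁ × 0` and `{(x, 0)} × 0 × F₂` into `M` and `M'` and the rest of `D̄` off
them, with corners at `p` and `q`.  This file assembles that construction from the bricks
formalised for this purpose, following Milnor's proof (PDF pp. 41–45) read in a Euclidean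
embedding `ι : V ↪ ℝᴺ` with a smooth normal retraction (`NormalRetraction.lean`) in place of
the Riemannian exponential map:

1. the arcs `C ⊂ M`, `C' ⊂ M'` from `p` to `q` with product neighbourhoods
   (`FramedArcThroughTwoPoints.lean`, Thm. 6.6 Remark);
2. the core of the disc near `C ∪ C'` with the corner conditions of Lemma 6.7
   (`WhitneyDiscCollarCore.lean`), its extension to an embedded disc missing `M ∪ M'`
   elsewhere — Lemmas 6.10–6.12: general position in dimension `≥ 5` and
   `π₁(V ∖ (M ∪ M')) = 0` (`WhitneyDiscCore.lean`, `HCobordismWhitneyTrickProofs.lean`);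
3. Lemma 6.13, the frame fields `ξ`, `η` over the disc (`WhitneyDiscFrames.lean`), whose
   orientation input along `C'` is exactly the hypothesis on the two intersection signs
   (`WhitneySignCondition.lean`, `ComplementaryFrameAlongArc.lean`);
4. the thickening `Θ` by the uniform fibre formula (`WhitneyThickening.lean`).

* `Literature.Topology.FourManifolds.Milnor1965_whitney_isotopy_holds` — Theorem 6.6.

Everything is proved; no definitions, no named facts.

## References

* J. Milnor, *Lectures on the h-cobordism theorem*, notes by L. Siebenmann and J. Sondow,
  Princeton Mathematical Notes (1965), Thm. 6.6, Lemmas 6.7–6.13 and their proofs,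
  PDF pp. 39–45.  Held: `lit read book:milnornd-lectures-h-cobordism-theorem --pages 39-45`.
  [MilnorHCobordism1965]
-/

open Set Function Filter Module Metric Topology
open scoped Manifold ContDiff Topology

noncomputable section

namespace Literature.Topology.FourManifolds

/-! ### Two lemmas on the normal retraction and on transversality -/

/-- **The normal retraction kills normal directions**: `dr_{ι v} w = 0` for `w ⊥ T_v`, since
`r (ι v + w) = v` for all small normal `w`. [folklore] -/
theorem mfderiv_normalRetraction_apply_eq_zero {n N : ℕ} {V : Type*} [TopologicalSpace V]
    [ChartedSpace (EuclideanSpace ℝ (Fin n)) V] [IsManifold (𝓡 n) ∞ V] [Nonempty V]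
    {ι : V → EuclideanSpace ℝ (Fin N)} {ε : ℝ}
    (hT : IsOpen (normalTube (𝓡 n) ι ε))
    (hr : ContMDiffOn 𝓘(ℝ, EuclideanSpace ℝ (Fin N)) (𝓡 n) ∞ (normalRetraction (𝓡 n) ι ε)
      (normalTube (𝓡 n) ι ε))
    (hre : ∀ (x : V) (v : EuclideanSpace ℝ (Fin N)), v ∈ normalSpace (𝓡 n) ι x → ‖v‖ < ε →
      ι x + v ∈ normalTube (𝓡 n) ι ε ∧ normalRetraction (𝓡 n) ι ε (ι x + v) = x)
    (hε : 0 < ε) (v : V) {w : EuclideanSpace ℝ (Fin N)} (hw : w ∈ (tangentPlane (𝓡 n) ι v)ᗮ) :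
    mfderiv 𝓘(ℝ, EuclideanSpace ℝ (Fin N)) (𝓡 n) (normalRetraction (𝓡 n) ι ε) (ι v) w = 0 := by
  set rV := normalRetraction (𝓡 n) ι ε with hrV
  set γ : ℝ → EuclideanSpace ℝ (Fin N) := fun t => ι v + t • w with hγ
  have hγ0 : γ 0 = ι v := by simp [hγ]
  have hγf : HasFDerivAt γ ((ContinuousLinearMap.id ℝ ℝ).smulRight w) 0 := by
    have h : HasFDerivAt (fun t : ℝ => ι v + t • w) ((ContinuousLinearMap.id ℝ ℝ).smulRight w) 0 :=
      ((hasFDerivAt_id (0 : ℝ)).smul_const w).const_add (ι v)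
    exact h
  have h0T : ι v ∈ normalTube (𝓡 n) ι ε := by
    simpa using (hre v 0 (Submodule.zero_mem _) (by simpa using hε)).1
  have hrd : MDifferentiableAt 𝓘(ℝ, EuclideanSpace ℝ (Fin N)) (𝓡 n) rV (ι v) :=
    (hr.contMDiffAt (hT.mem_nhds h0T)).mdifferentiableAt (by simp)
  have hg : HasMFDerivAt 𝓘(ℝ, EuclideanSpace ℝ (Fin N)) (𝓡 n) rV (γ 0)
      (mfderiv 𝓘(ℝ, EuclideanSpace ℝ (Fin N)) (𝓡 n) rV (ι v)) := by
    rw [hγ0]; exact hrd.hasMFDerivAt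
  have hcomp : HasMFDerivAt 𝓘(ℝ, ℝ) (𝓡 n) (rV ∘ γ) 0
      ((mfderiv 𝓘(ℝ, EuclideanSpace ℝ (Fin N)) (𝓡 n) rV (ι v)).comp
        ((ContinuousLinearMap.id ℝ ℝ).smulRight w)) := hg.comp 0 hγf.hasMFDerivAt
  -- the composite is constant `= v` near `0`
  have hconst : (rV ∘ γ) =ᶠ[𝓝 0] fun _ => v := by
    have hsmall : ∀ᶠ t : ℝ in 𝓝 0, ‖t • w‖ < ε := by
      have hc : Continuous fun t : ℝ => ‖t • w‖ := (continuous_id.smul continuous_const).norm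
      have := hc.tendsto 0
      simp only [zero_smul, norm_zero] at this
      exact this.eventually (gt_mem_nhds hε)
    filter_upwards [hsmall] with t ht
    exact (hre v (t • w) (Submodule.smul_mem _ t hw) ht).2
  have hzero : HasMFDerivAt 𝓘(ℝ, ℝ) (𝓡 n) (rV ∘ γ) 0
      (0 : TangentSpace 𝓘(ℝ, ℝ) (0 : ℝ) →L[ℝ] TangentSpace (𝓡 n) v) :=
    (hasMFDerivAt_const (I := 𝓘(ℝ, ℝ)) (I' := 𝓡 n) v (0 : ℝ)).congr_of_eventuallyEq hconst
  have huniq := hasMFDerivAt_unique hcomp hzero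
  have h1 := DFunLike.congr_fun huniq (1 : ℝ)
  have h3 : mfderiv 𝓘(ℝ, EuclideanSpace ℝ (Fin N)) (𝓡 n) rV (ι v) ((1 : ℝ) • w) = 0 := h1
  rwa [one_smul] at h3

/-- **Transverse sheets have trivially intersecting tangent images in `ℝᴺ`.**  At a double
point `e (Λ₁ z₁) = e' (Λ₂ z₂)` where `(e', e)` is transverse (the crossing matrix
`[de' | de]` is invertible), the ranges of `d(ι e Λ₁)_{z₁}` and `d(ι e' Λ₂)_{z₂}` in `ℝᴺ`
meet in `0`, for any immersion `ι` of `V`. [cite: MilnorHCobordism1965, Def. 5.1 (PDF p. 26)] -/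
theorem range_fderiv_inf_eq_bot_of_mapsTransverseAt {n N r s : ℕ}
    {V : Type*} [TopologicalSpace V] [ChartedSpace (EuclideanSpace ℝ (Fin n)) V]
    [IsManifold (𝓡 n) ∞ V]
    {P : Type*} [TopologicalSpace P] [ChartedSpace (EuclideanSpace ℝ (Fin r)) P]
    [IsManifold (𝓡 r) ∞ P]
    {Q : Type*} [TopologicalSpace Q] [ChartedSpace (EuclideanSpace ℝ (Fin s)) Q]
    [IsManifold (𝓡 s) ∞ Q] (h : s + r = n)
    {ι : V → EuclideanSpace ℝ (Fin N)} (hι : ContMDiff (𝓡 n) 𝓘(ℝ, EuclideanSpace ℝ (Fin N)) ∞ ι)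
    (hιimm : ∀ v, Injective (mfderiv (𝓡 n) 𝓘(ℝ, EuclideanSpace ℝ (Fin N)) ι v))
    {e : P → V} (he : ContMDiff (𝓡 r) (𝓡 n) ∞ e) {e' : Q → V} (he' : ContMDiff (𝓡 s) (𝓡 n) ∞ e')
    {F₁ F₂ : Type*} [NormedAddCommGroup F₁] [NormedSpace ℝ F₁] [NormedAddCommGroup F₂]
    [NormedSpace ℝ F₂] {Λ₁ : ℝ × F₁ → P} (hΛ₁ : ContMDiff 𝓘(ℝ, ℝ × F₁) (𝓡 r) ∞ Λ₁)
    {Λ₂ : ℝ × F₂ → Q} (hΛ₂ : ContMDiff 𝓘(ℝ, ℝ × F₂) (𝓡 s) ∞ Λ₂) {z₁ : ℝ × F₁} {z₂ : ℝ × F₂}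
    (hpt : e (Λ₁ z₁) = e' (Λ₂ z₂))
    (htr : MapsTransverseAt (𝓡 s) (𝓡 r) (𝓡 n) h e' e (Λ₂ z₂) (Λ₁ z₁)) :
    LinearMap.range (fderiv ℝ (ι ∘ e ∘ Λ₁) z₁ : ℝ × F₁ →ₗ[ℝ] EuclideanSpace ℝ (Fin N)) ⊓
      LinearMap.range (fderiv ℝ (ι ∘ e' ∘ Λ₂) z₂ : ℝ × F₂ →ₗ[ℝ] EuclideanSpace ℝ (Fin N)) = ⊥ := by
  have htop : ((∞ : WithTop ℕ∞)) ≠ 0 := by simp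
  -- the crossing endomorphism `T₀ = de' x⃗ + de y⃗` is injective
  set U : EuclideanSpace ℝ (Fin s) →L[ℝ] EuclideanSpace ℝ (Fin n) := mfderiv (𝓡 s) (𝓡 n) e' (Λ₂ z₂)
    with hU
  set W : EuclideanSpace ℝ (Fin r) →L[ℝ] EuclideanSpace ℝ (Fin n) := mfderiv (𝓡 r) (𝓡 n) e (Λ₁ z₁)
    with hW
  set T₀ : EuclideanSpace ℝ (Fin n) →ₗ[ℝ] EuclideanSpace ℝ (Fin n) :=
    (U : EuclideanSpace ℝ (Fin s) →ₗ[ℝ] EuclideanSpace ℝ (Fin n)) ∘ₗ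
      ((lowerProj s n : EuclideanSpace ℝ (Fin n) →L[ℝ] EuclideanSpace ℝ (Fin s)) :
        EuclideanSpace ℝ (Fin n) →ₗ[ℝ] EuclideanSpace ℝ (Fin s)) +
    (W : EuclideanSpace ℝ (Fin r) →ₗ[ℝ] EuclideanSpace ℝ (Fin n)) ∘ₗ
      ((upperProj s r n : EuclideanSpace ℝ (Fin n) →L[ℝ] EuclideanSpace ℝ (Fin r)) :
        EuclideanSpace ℝ (Fin n) →ₗ[ℝ] EuclideanSpace ℝ (Fin r)) with hT₀
  have hdet : LinearMap.det T₀ ≠ 0 := by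
    have h1 : (crossingMatrixAt (𝓡 s) (𝓡 r) (𝓡 n) h e' e (Λ₂ z₂) (Λ₁ z₁)).det ≠ 0 := htr
    unfold crossingMatrixAt at h1
    rwa [det_crossingMatrix_eq_det_frame] at h1
  have hT₀inj : Injective T₀ :=
    ((Module.End.isUnit_iff _).1 ((LinearMap.isUnit_iff_isUnit_det _).2
      (isUnit_iff_ne_zero.2 hdet))).1
  -- chain rules
  set v₀ := e (Λ₁ z₁) with hv₀
  have hιd : MDifferentiableAt (𝓡 n) 𝓘(ℝ, EuclideanSpace ℝ (Fin N)) ι v₀ :=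
    (hι v₀).mdifferentiableAt htop
  have h1 : fderiv ℝ (ι ∘ e ∘ Λ₁) z₁ = (mfderiv (𝓡 n) 𝓘(ℝ, EuclideanSpace ℝ (Fin N)) ι v₀).comp
      (W.comp (mfderiv 𝓘(ℝ, ℝ × F₁) (𝓡 r) Λ₁ z₁)) := by
    rw [← mfderiv_eq_fderiv]
    have hcomp := mfderiv_comp z₁ (((hι _).comp _ (he _)).mdifferentiableAt htop)
      ((hΛ₁ z₁).mdifferentiableAt htop) (I' := 𝓡 r) (g := ι ∘ e) (f := Λ₁)
    rw [show ι ∘ e ∘ Λ₁ = (ι ∘ e) ∘ Λ₁ from rfl, hcomp,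
      mfderiv_comp (Λ₁ z₁) hιd ((he _).mdifferentiableAt htop)]
    rfl
  have hιd' : MDifferentiableAt (𝓡 n) 𝓘(ℝ, EuclideanSpace ℝ (Fin N)) ι (e' (Λ₂ z₂)) := by
    rw [← hpt]; exact hιd
  have h2 : fderiv ℝ (ι ∘ e' ∘ Λ₂) z₂ =
      (mfderiv (𝓡 n) 𝓘(ℝ, EuclideanSpace ℝ (Fin N)) ι (e' (Λ₂ z₂))).comp
        (U.comp (mfderiv 𝓘(ℝ, ℝ × F₂) (𝓡 s) Λ₂ z₂)) := by
    rw [← mfderiv_eq_fderiv]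
    have hcomp := mfderiv_comp z₂ (((hι _).comp _ (he' _)).mdifferentiableAt htop)
      ((hΛ₂ z₂).mdifferentiableAt htop) (I' := 𝓡 s) (g := ι ∘ e') (f := Λ₂)
    rw [show ι ∘ e' ∘ Λ₂ = (ι ∘ e') ∘ Λ₂ from rfl, hcomp,
      mfderiv_comp (Λ₂ z₂) hιd' ((he' _).mdifferentiableAt htop)]
    rfl
  -- `dι` at the two (equal) base points agree
  have hdι : ∀ t, mfderiv (𝓡 n) 𝓘(ℝ, EuclideanSpace ℝ (Fin N)) ι (e' (Λ₂ z₂)) t =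
      mfderiv (𝓡 n) 𝓘(ℝ, EuclideanSpace ℝ (Fin N)) ι v₀ t := by
    intro t
    have key : ∀ {p : V} (_ : p = v₀), mfderiv (𝓡 n) 𝓘(ℝ, EuclideanSpace ℝ (Fin N)) ι p t =
        mfderiv (𝓡 n) 𝓘(ℝ, EuclideanSpace ℝ (Fin N)) ι v₀ t := by
      rintro p rfl; rfl
    exact key hpt.symm
  -- conclusion
  rw [Submodule.eq_bot_iff]
  rintro v ⟨⟨a, rfl⟩, ⟨b, hb⟩⟩
  have ha : (fderiv ℝ (ι ∘ e ∘ Λ₁) z₁ : ℝ × F₁ →ₗ[ℝ] EuclideanSpace ℝ (Fin N)) a =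
      mfderiv (𝓡 n) 𝓘(ℝ, EuclideanSpace ℝ (Fin N)) ι v₀ (W (mfderiv 𝓘(ℝ, ℝ × F₁) (𝓡 r) Λ₁ z₁ a)) := by
    rw [ContinuousLinearMap.coe_coe, h1]; rfl
  have hb' : (fderiv ℝ (ι ∘ e' ∘ Λ₂) z₂ : ℝ × F₂ →ₗ[ℝ] EuclideanSpace ℝ (Fin N)) b =
      mfderiv (𝓡 n) 𝓘(ℝ, EuclideanSpace ℝ (Fin N)) ι v₀ (U (mfderiv 𝓘(ℝ, ℝ × F₂) (𝓡 s) Λ₂ z₂ b)) := by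
    rw [ContinuousLinearMap.coe_coe, h2, ← hdι]; rfl
  set α : EuclideanSpace ℝ (Fin r) := mfderiv 𝓘(ℝ, ℝ × F₁) (𝓡 r) Λ₁ z₁ a with hα
  set β : EuclideanSpace ℝ (Fin s) := mfderiv 𝓘(ℝ, ℝ × F₂) (𝓡 s) Λ₂ z₂ b with hβ
  have heq : W α = U β := hιimm v₀ (by rw [← ha, ← hb', hb])
  have hlow : lowerProj s n (lowerEmb s n β - upperEmb s r n α) = β := by
    rw [map_sub, lowerProj_lowerEmb (show s ≤ n by omega), lowerProj_upperEmb, sub_zero]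
  have hup : upperProj s r n (lowerEmb s n β - upperEmb s r n α) = -α := by
    rw [map_sub, upperProj_lowerEmb, upperProj_upperEmb h.le, zero_sub]
  have hu : T₀ (lowerEmb s n β - upperEmb s r n α) = 0 := by
    show U (lowerProj s n (lowerEmb s n β - upperEmb s r n α)) +
      W (upperProj s r n (lowerEmb s n β - upperEmb s r n α)) = 0
    rw [hlow, hup, W.map_neg, heq, add_neg_cancel]
  have h0 : lowerEmb s n β - upperEmb s r n α = 0 := (injective_iff_map_eq_zero _).1 hT₀inj _ hu
  have hβ0 : β = 0 := by rw [← hlow, h0, (lowerProj s n).map_zero]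
  rw [ha, heq, hβ0, U.map_zero]
  exact (mfderiv (𝓡 n) 𝓘(ℝ, EuclideanSpace ℝ (Fin N)) ι v₀).map_zero

/-! ### Theorem 6.6 -/

set_option maxHeartbeats 3200000 in
/-- **Milnor 1965, Theorem 6.6 (the Whitney trick) — discharge of the tree's fact
`Literature.Topology.FourManifolds.Milnor1965_whitney_isotopy`.**  The proof follows Milnor
(PDF pp. 39–45) through the reduction
`Literature.Topology.FourManifolds.Milnor1965_whitney_isotopy_of_sheetModels` (Lemma 6.7 in
sheet form ⇒ Thm. 6.6, via the standard model, Lemma 6.8): arcs `C`, `C'` (Remark to Thm. 6.6),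
the embedded disc (Lemmas 6.10–6.12 through the core near `C ∪ C'`), the frame fields
(Lemma 6.13, using the opposite signs at `p`, `q`) and the thickening, all read in a Euclidean
embedding of `V` with a normal retraction.
[cite: MilnorHCobordism1965, Thm. 6.6, Lemmas 6.7–6.13 (PDF pp. 39–45)] -/
theorem Milnor1965_whitney_isotopy_holds : Milnor1965_whitney_isotopy := by
  refine Milnor1965_whitney_isotopy_of_sheetModels ?_
  intro n r s hrs hn hr hs V _ _ _ _ _ _ _ P _ _ _ _ _ Q _ _ _ _ _ e he e' he' oP oQ oV hπ hfin
    htr htr' x₁ y₁ h₁ x₂ y₂ h₂ hs₁ hs₂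
  have htop : ((∞ : WithTop ℕ∞)) ≠ 0 := by simp
  ------------------------------------------------------------------------------------------
  -- Step 1: the two submanifolds
  ------------------------------------------------------------------------------------------
  have hec : ContMDiff (𝓡 r) (𝓡 n) ∞ e := he.isImmersion.contMDiff
  have he'c : ContMDiff (𝓡 s) (𝓡 n) ∞ e' := he'.isImmersion.contMDiff
  have heimm : ∀ x, Injective (mfderiv (𝓡 r) (𝓡 n) e x) :=
    mfderiv_injective_of_isImmersion he.isImmersion (by simp)
  have he'imm : ∀ y, Injective (mfderiv (𝓡 s) (𝓡 n) e' y) :=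
    mfderiv_injective_of_isImmersion he'.isImmersion (by simp)
  have heC : IsClosed (range e) := (isCompact_range he.isEmbedding.continuous).isClosed
  have he'C : IsClosed (range e') := (isCompact_range he'.isEmbedding.continuous).isClosed
  haveI : T2Space P := he.isEmbedding.t2Space
  haveI : T2Space Q := he'.isEmbedding.t2Space
  haveI : Nonempty V := ⟨e x₁⟩
  -- the two corners are distinct
  have hx : x₁ ≠ x₂ := by
    rintro rfl
    have hy : y₁ = y₂ := he'.isEmbedding.injective (h₁.symm.trans h₂)
    subst hy
    rw [hs₁] at hs₂
    norm_num at hs₂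
  have hy : y₁ ≠ y₂ := by
    rintro rfl
    have hx' : x₁ = x₂ := he.isEmbedding.injective (h₁.trans h₂.symm)
    exact hx hx'
  ------------------------------------------------------------------------------------------
  -- Step 2: a Euclidean embedding of `V` and a smooth normal retraction
  ------------------------------------------------------------------------------------------
  obtain ⟨N, ι, hι, hιemb, hιimm⟩ := exists_embedding_euclidean_of_compact (I := 𝓡 n) (M := V)
  have hnN : n ≤ N := by
    set L : EuclideanSpace ℝ (Fin n) →L[ℝ] EuclideanSpace ℝ (Fin N) :=
      mfderiv (𝓡 n) 𝓘(ℝ, EuclideanSpace ℝ (Fin N)) ι (e x₁) with hL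
    have hLi : Injective L := hιimm (e x₁)
    have := LinearMap.finrank_le_finrank_of_injective
      (f := (L : EuclideanSpace ℝ (Fin n) →ₗ[ℝ] EuclideanSpace ℝ (Fin N))) hLi
    simpa [finrank_euclideanSpace_fin] using this
  obtain ⟨ε, hε, hTopen, hrT, hre⟩ := exists_normalRetraction (I := 𝓡 n) hι hιemb.injective hιimm
  set T := normalTube (𝓡 n) ι ε with hT
  set rV := normalRetraction (𝓡 n) ι ε with hrV
  have hιT : ∀ v : V, ι v ∈ T := fun v => by
    simpa [hT] using (hre v 0 (Submodule.zero_mem _) (by simpa using hε)).1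
  have hrι : ∀ v : V, rV (ι v) = v := fun v => by
    simpa [hrV] using (hre v 0 (Submodule.zero_mem _) (by simpa using hε)).2
  have hrN : ∀ v, ∀ w ∈ (tangentPlane (𝓡 n) ι v)ᗮ,
      mfderiv 𝓘(ℝ, EuclideanSpace ℝ (Fin N)) (𝓡 n) rV (ι v) w = 0 := fun v w hw =>
    mfderiv_normalRetraction_apply_eq_zero hTopen hrT hre hε v hw
  ------------------------------------------------------------------------------------------
  -- Step 3: the arcs `C ⊂ M` from `p` to `q` and `C' ⊂ M'`, with product neighbourhoods
  ------------------------------------------------------------------------------------------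
  have hF₁ : finrank ℝ (EuclideanSpace ℝ (Fin (r - 1))) + 1 = r := by
    rw [finrank_euclideanSpace_fin]; omega
  have hF₂ : finrank ℝ (EuclideanSpace ℝ (Fin (s - 1))) + 1 = s := by
    rw [finrank_euclideanSpace_fin]; omega
  -- the other double points, seen in `P` and in `Q`
  set B₁ : Set P := {x : P | e x ∈ range e'} \ {x₁, x₂} with hB₁
  set B₂ : Set Q := {y : Q | e' y ∈ range e} \ {y₁, y₂} with hB₂
  have hB₁f : B₁.Finite := by
    refine Finite.sdiff ?_
    have : {x : P | e x ∈ range e'} = e ⁻¹' (range e ∩ range e') := by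
      ext x; simp
    rw [this]
    exact hfin.preimage he.isEmbedding.injective.injOn
  have hB₂f : B₂.Finite := by
    refine Finite.sdiff ?_
    have : {y : Q | e' y ∈ range e} = e' ⁻¹' (range e ∩ range e') := by
      ext y; simp
    rw [this]
    exact hfin.preimage he'.isEmbedding.injective.injOn
  obtain ⟨Λ₁, hΛ₁, hΛ₁i, hΛ₁d, hΛ₁a, hΛ₁b, hΛ₁B⟩ := exists_framedArc (P := P) hr hF₁ hx hB₁f
    (fun h => h.2 (Or.inl rfl)) (fun h => h.2 (Or.inr rfl))
  obtain ⟨Λ₂, hΛ₂, hΛ₂i, hΛ₂d, hΛ₂a, hΛ₂b, hΛ₂B⟩ := exists_framedArc (P := Q) (by omega) hF₂ hy hB₂f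
    (fun h => h.2 (Or.inl rfl)) (fun h => h.2 (Or.inr rfl))
  have hΛ₁imm : ∀ z, Injective (mfderiv 𝓘(ℝ, ℝ × EuclideanSpace ℝ (Fin (r - 1))) (𝓡 r) Λ₁ z) :=
    fun z => ((hΛ₁d z).mfderivToContinuousLinearEquiv htop).injective
  have hΛ₂imm : ∀ z, Injective (mfderiv 𝓘(ℝ, ℝ × EuclideanSpace ℝ (Fin (s - 1))) (𝓡 s) Λ₂ z) :=
    fun z => ((hΛ₂d z).mfderivToContinuousLinearEquiv htop).injective
  -- the sheets `m₁ = e ∘ Λ₁`, `m₂ = e' ∘ Λ₂`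
  have hm₁ : ContMDiff 𝓘(ℝ, ℝ × EuclideanSpace ℝ (Fin (r - 1))) (𝓡 n) ∞ (e ∘ Λ₁) := hec.comp hΛ₁
  have hm₂ : ContMDiff 𝓘(ℝ, ℝ × EuclideanSpace ℝ (Fin (s - 1))) (𝓡 n) ∞ (e' ∘ Λ₂) := he'c.comp hΛ₂
  have hm₁i : ∀ z, Injective (mfderiv 𝓘(ℝ, ℝ × EuclideanSpace ℝ (Fin (r - 1))) (𝓡 n) (e ∘ Λ₁) z) := by
    intro z
    rw [mfderiv_comp z ((hec _).mdifferentiableAt htop) ((hΛ₁ z).mdifferentiableAt htop)]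
    exact (heimm _).comp (hΛ₁imm z)
  have hm₂i : ∀ z, Injective (mfderiv 𝓘(ℝ, ℝ × EuclideanSpace ℝ (Fin (s - 1))) (𝓡 n) (e' ∘ Λ₂) z) := by
    intro z
    rw [mfderiv_comp z ((he'c _).mdifferentiableAt htop) ((hΛ₂ z).mdifferentiableAt htop)]
    exact (he'imm _).comp (hΛ₂imm z)
  -- incidences at the corners and nowhere else
  have hpa : e (Λ₁ (-1, 0)) = e' (Λ₂ (-1, 0)) := by rw [hΛ₁a, hΛ₂a]; exact h₁
  have hqb : e (Λ₁ (1, 0)) = e' (Λ₂ (1, 0)) := by rw [hΛ₁b, hΛ₂b]; exact h₂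
  have hdp₁ : ∀ z, e (Λ₁ z) ∈ range e' → z = (-1, 0) ∨ z = (1, 0) := by
    intro z hz
    by_cases h0 : Λ₁ z = x₁ ∨ Λ₁ z = x₂
    · rcases h0 with h0 | h0
      · left; apply hΛ₁i; rw [h0, hΛ₁a]
      · right; apply hΛ₁i; rw [h0, hΛ₁b]
    · exfalso
      have hmem : Λ₁ z ∈ B₁ := ⟨hz, h0⟩
      exact Set.disjoint_left.1 hΛ₁B ⟨z, rfl⟩ hmem
  have hdp₂ : ∀ z, e' (Λ₂ z) ∈ range e → z = (-1, 0) ∨ z = (1, 0) := by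
    intro z hz
    by_cases h0 : Λ₂ z = y₁ ∨ Λ₂ z = y₂
    · rcases h0 with h0 | h0
      · left; apply hΛ₂i; rw [h0, hΛ₂a]
      · right; apply hΛ₂i; rw [h0, hΛ₂b]
    · exfalso
      have hmem : Λ₂ z ∈ B₂ := ⟨hz, h0⟩
      exact Set.disjoint_left.1 hΛ₂B ⟨z, rfl⟩ hmem
  -- transversality at the corners, read in `ℝᴺ`
  have htrc : ∀ x : ℝ, x = -1 ∨ x = 1 →
      LinearMap.range (fderiv ℝ (ι ∘ e ∘ Λ₁) (x, 0) :
        ℝ × EuclideanSpace ℝ (Fin (r - 1)) →ₗ[ℝ] EuclideanSpace ℝ (Fin N)) ⊓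
      LinearMap.range (fderiv ℝ (ι ∘ e' ∘ Λ₂) (x, 0) :
        ℝ × EuclideanSpace ℝ (Fin (s - 1)) →ₗ[ℝ] EuclideanSpace ℝ (Fin N)) = ⊥ := by
    intro x hx0
    have hpt : e (Λ₁ (x, 0)) = e' (Λ₂ (x, 0)) := by
      rcases hx0 with rfl | rfl; exacts [hpa, hqb]
    exact range_fderiv_inf_eq_bot_of_mapsTransverseAt (Nat.add_comm s r ▸ hrs) hι hιimm hec he'c
      hΛ₁ hΛ₂ hpt (htr' _ _ hpt.symm)
  ------------------------------------------------------------------------------------------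
  -- Step 4: the core near `C ∪ C'` (Lemma 6.7's corner conditions) and the embedded disc
  -- (Lemmas 6.10–6.12)
  ------------------------------------------------------------------------------------------
  have hdim₁ : finrank ℝ (ℝ × EuclideanSpace ℝ (Fin (r - 1))) + s = n := by
    rw [finrank_prod, Module.finrank_self, finrank_euclideanSpace_fin]; omega
  have hdim₂ : finrank ℝ (ℝ × EuclideanSpace ℝ (Fin (s - 1))) + r = n := by
    rw [finrank_prod, Module.finrank_self, finrank_euclideanSpace_fin]; omega
  obtain ⟨φc, 𝒰, -, h𝒰o, hK𝒰, hc₁, hc₂, -, hΦd, hΦinj, hΦimm, hΦoff₁, hΦoff₂, hΦfr₁, hΦfr₂⟩ :=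
    exists_whitneyCollarCore (P := P) (Q := Q) hι hιimm hTopen hrT hιT hrι hrN hnN he.isEmbedding
      heC hΛ₁d.isLocalHomeomorph hΛ₁i hm₁ hm₁i he'.isEmbedding he'C hΛ₂d.isLocalHomeomorph hΛ₂i
      hm₂ hm₂i hpa hqb hdp₁ hdp₂ htrc (by omega : 2 ≤ s) hdim₁ hr hdim₂
  have hsc : IsSimplyConnected (range e ∪ range e')ᶜ :=
    isSimplyConnected_compl_union_range_of_two_le hrs hr hs he he' hπ
  obtain ⟨φ, hφ, ⟨κ, hκ, harc⟩, hinjD, himmD, hoff₁, hoff₂, hfr₁, hfr₂⟩ :=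
    exists_whitneyDisc_of_germ hn (F₁ := EuclideanSpace ℝ (Fin (r - 1)))
      (F₂ := EuclideanSpace ℝ (Fin (s - 1))) (ι := ι) heC he'C hsc h𝒰o hK𝒰 hΦd hΦinj hΦimm
      hΦoff₁ hΦoff₂ (c₁ := fun x => e (Λ₁ (x, 0))) (c₂ := fun x => e' (Λ₂ (x, 0)))
      (fun x => by simp only [comp_apply, hc₁, hrι]) (fun x => by simp only [comp_apply, hc₂, hrι])
      (D₁ := fun x => fderiv ℝ (ι ∘ e ∘ Λ₁) (x, 0))
      (D₂ := fun x => fderiv ℝ (ι ∘ e' ∘ Λ₂) (x, 0)) hΦfr₁ hΦfr₂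
  have harc' : ∀ x : ℝ, |x| < 1 + κ →
      φ (x, x ^ 2 - 1) = (e ∘ Λ₁) (x, 0) ∧ φ (x, 0) = (e' ∘ Λ₂) (x, 0) := fun x hx => harc x hx
  ------------------------------------------------------------------------------------------
  -- Step 5: the normal frame of `V` along the disc, the sign condition, the field along `C'`
  ------------------------------------------------------------------------------------------
  obtain ⟨O₀, Nf, hO₀, -, hDO₀, hNfd, hNf⟩ := exists_discNormalFrame hι hιimm hφ hnN
  have haxO₀ : ∀ x ∈ Icc (-1 : ℝ) 1, ((x, 0) : ℝ × ℝ) ∈ O₀ := fun x hx =>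
    hDO₀ ⟨by simp only; nlinarith [hx.1, hx.2], le_rfl⟩
  have hs₁' : localIntersectionSign (𝓡 s) (𝓡 r) (𝓡 n) (Nat.add_comm s r ▸ hrs) oQ oP oV e' e
      (Λ₂ (-1, 0)) (Λ₁ (-1, 0)) = 1 := by rw [hΛ₂a, hΛ₁a]; exact hs₁
  have hs₂' : localIntersectionSign (𝓡 s) (𝓡 r) (𝓡 n) (Nat.add_comm s r ▸ hrs) oQ oP oV e' e
      (Λ₂ (1, 0)) (Λ₁ (1, 0)) = -1 := by rw [hΛ₂b, hΛ₁b]; exact hs₂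
  have hkA : finrank ℝ (EuclideanSpace ℝ (Fin (2 + (N - n) + (s - 1)))) =
      finrank ℝ (((ℝ × ℝ) × EuclideanSpace ℝ (Fin (N - n))) × EuclideanSpace ℝ (Fin (s - 1))) := by
    simp only [finrank_prod, finrank_euclideanSpace_fin, Module.finrank_self]
  set isoA : EuclideanSpace ℝ (Fin (2 + (N - n) + (s - 1))) ≃L[ℝ]
      ((ℝ × ℝ) × EuclideanSpace ℝ (Fin (N - n))) × EuclideanSpace ℝ (Fin (s - 1)) :=
    ContinuousLinearEquiv.ofFinrankEq hkA with hisoA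
  set isoΞ : EuclideanSpace ℝ (Fin (r - 1)) ≃L[ℝ] EuclideanSpace ℝ (Fin (r - 1)) :=
    ContinuousLinearEquiv.refl ℝ _ with hisoΞ
  obtain ⟨hbm, hbp, hdet⟩ := exists_pos_det_cornerFrames oV oP oQ (Nat.add_comm s r ▸ hrs) hnN hι
    hιimm hec heimm he'c he'imm hF₁ hF₂ hΛ₁ hΛ₁imm hΛ₂ hΛ₂imm hφ hκ (fun x hx => harc x hx) haxO₀
    hNfd.continuousOn hNf hs₁' hs₂' isoA isoΞ
  -- the frame `[dΨ | Nf | ∂_w(ι m₂)]` along the axis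
  set A : ℝ → (EuclideanSpace ℝ (Fin (2 + (N - n) + (s - 1))) →L[ℝ] EuclideanSpace ℝ (Fin N)) :=
    fun x => ((((fderiv ℝ (ι ∘ φ) (x, 0)).coprod (Nf (x, 0))).coprod
      ((fderiv ℝ (ι ∘ e' ∘ Λ₂) (x, 0)).comp
        (ContinuousLinearMap.inr ℝ ℝ (EuclideanSpace ℝ (Fin (s - 1)))))).comp
      (isoA : EuclideanSpace ℝ (Fin (2 + (N - n) + (s - 1))) →L[ℝ]
        ((ℝ × ℝ) × EuclideanSpace ℝ (Fin (N - n))) × EuclideanSpace ℝ (Fin (s - 1)))) with hA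
  have hU₀ : IsOpen {x : ℝ | ((x, 0) : ℝ × ℝ) ∈ O₀} :=
    hO₀.preimage (continuous_id.prodMk continuous_const)
  have hIU₀ : Icc (-1 : ℝ) 1 ⊆ {x : ℝ | ((x, 0) : ℝ × ℝ) ∈ O₀} := fun x hx => haxO₀ x hx
  have hΨd : ContDiff ℝ ∞ (ι ∘ φ) := by rw [← contMDiff_iff_contDiff]; exact hι.comp hφ
  have hμ'd : ContDiff ℝ ∞ (ι ∘ e' ∘ Λ₂) := by rw [← contMDiff_iff_contDiff]; exact hι.comp hm₂
  have hAd : ContDiffOn ℝ ∞ A {x : ℝ | ((x, 0) : ℝ × ℝ) ∈ O₀} := by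
    have h1 : ContDiff ℝ ∞ fun x : ℝ => fderiv ℝ (ι ∘ φ) (x, 0) :=
      (contDiff_infty_iff_fderiv.1 hΨd).2.comp (contDiff_id.prodMk contDiff_const)
    have h2 : ContDiffOn ℝ ∞ (fun x : ℝ => Nf (x, 0)) {x : ℝ | ((x, 0) : ℝ × ℝ) ∈ O₀} :=
      hNfd.comp (contDiff_id.prodMk contDiff_const).contDiffOn fun x hx => hx
    have h3 : ContDiff ℝ ∞ fun x : ℝ => fderiv ℝ (ι ∘ e' ∘ Λ₂) (x, 0) :=
      (contDiff_infty_iff_fderiv.1 hμ'd).2.comp (contDiff_id.prodMk contDiff_const)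
    have : ContDiffOn ℝ ∞ (fun x : ℝ => (((fderiv ℝ (ι ∘ φ) (x, 0)).comp
        (ContinuousLinearMap.fst ℝ (ℝ × ℝ) (EuclideanSpace ℝ (Fin (N - n)))) +
        (Nf (x, 0)).comp (ContinuousLinearMap.snd ℝ (ℝ × ℝ) (EuclideanSpace ℝ (Fin (N - n))))).comp
        (ContinuousLinearMap.fst ℝ ((ℝ × ℝ) × EuclideanSpace ℝ (Fin (N - n)))
          (EuclideanSpace ℝ (Fin (s - 1)))) +
        ((fderiv ℝ (ι ∘ e' ∘ Λ₂) (x, 0)).comp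
          (ContinuousLinearMap.inr ℝ ℝ (EuclideanSpace ℝ (Fin (s - 1))))).comp
        (ContinuousLinearMap.snd ℝ ((ℝ × ℝ) × EuclideanSpace ℝ (Fin (N - n)))
          (EuclideanSpace ℝ (Fin (s - 1))))).comp
        (isoA : EuclideanSpace ℝ (Fin (2 + (N - n) + (s - 1))) →L[ℝ]
          ((ℝ × ℝ) × EuclideanSpace ℝ (Fin (N - n))) × EuclideanSpace ℝ (Fin (s - 1))))
        {x : ℝ | ((x, 0) : ℝ × ℝ) ∈ O₀} :=
      ((((h1.contDiffOn.clm_comp contDiffOn_const).add (h2.clm_comp contDiffOn_const)).clm_comp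
        contDiffOn_const).add ((h3.contDiffOn.clm_comp contDiffOn_const).clm_comp
          contDiffOn_const)).clm_comp contDiffOn_const
    exact this
  have hTN : ∀ x ∈ Icc (-1 : ℝ) 1, ∀ t ∈ tangentPlane (𝓡 n) ι (φ (x, 0)), ∀ ν,
      t + Nf (x, 0) ν = 0 → t = 0 ∧ ν = 0 := by
    intro x hx t ht ν h0
    have hu := haxO₀ x hx
    have hν : Nf (x, 0) ν ∈ (tangentPlane (𝓡 n) ι (φ (x, 0)))ᗮ := by
      rw [← (hNf _ hu).2]; exact ⟨ν, rfl⟩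
    have ht' : t ∈ (tangentPlane (𝓡 n) ι (φ (x, 0)))ᗮ := by
      have : t = -Nf (x, 0) ν := eq_neg_of_add_eq_zero_left h0
      rw [this]; exact Submodule.neg_mem _ hν
    have ht0 : t = 0 := by
      have : t ∈ tangentPlane (𝓡 n) ι (φ (x, 0)) ⊓ (tangentPlane (𝓡 n) ι (φ (x, 0)))ᗮ := ⟨ht, ht'⟩
      rwa [Submodule.inf_orthogonal_eq_bot, Submodule.mem_bot] at this
    refine ⟨ht0, (hNf _ hu).1 ?_⟩
    rw [ht0, zero_add] at h0
    rw [h0, map_zero]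
  have hA'inj : ∀ x ∈ Icc (-1 : ℝ) 1, Injective (((fderiv ℝ (ι ∘ φ) (x, 0)).coprod (Nf (x, 0))).coprod
      ((fderiv ℝ (ι ∘ e' ∘ Λ₂) (x, 0)).comp
        (ContinuousLinearMap.inr ℝ ℝ (EuclideanSpace ℝ (Fin (s - 1)))))) := by
    intro x hx
    refine (injective_iff_map_eq_zero _).2 fun q hq => ?_
    obtain ⟨⟨w, ν⟩, f⟩ := q
    rw [ContinuousLinearMap.coprod_apply, ContinuousLinearMap.coprod_apply] at hq
    have ht : fderiv ℝ (ι ∘ φ) (x, 0) w + fderiv ℝ (ι ∘ e' ∘ Λ₂) (x, 0) (0, f) ∈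
        tangentPlane (𝓡 n) ι (φ (x, 0)) := by
      refine Submodule.add_mem _ (range_fderiv_comp_le_tangentPlane hι hφ (x, 0) ⟨w, rfl⟩) ?_
      have hxa : |x| < 1 + κ := by rw [abs_lt]; constructor <;> linarith [hx.1, hx.2]
      rw [(harc x hxa).2]
      exact range_fderiv_comp_le_tangentPlane hι hm₂ (x, 0) ⟨_, rfl⟩
    obtain ⟨h1, h2⟩ := hTN x hx _ ht ν (by rw [← hq]; simp only [ContinuousLinearMap.coe_comp,
      comp_apply, ContinuousLinearMap.inr_apply]; abel)
    have h3 := hfr₂ x hx (a₁ := (w, f)) (a₂ := 0) (by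
      simp only [Prod.fst_zero, Prod.snd_zero, Prod.mk_zero_zero, map_zero, zero_add]
      exact h1)
    simp only [Prod.mk_eq_zero] at h3
    rw [h3.1, h3.2, h2]; rfl
  have hAinj : ∀ x ∈ Icc (-1 : ℝ) 1, Injective (A x) := fun x hx =>
    (hA'inj x hx).comp isoA.injective
  have hdimA : (2 + (N - n) + (s - 1)) + (r - 1) = finrank ℝ (EuclideanSpace ℝ (Fin N)) := by
    rw [finrank_euclideanSpace_fin]; omega
  obtain ⟨Vs, Ξ, hVs, hIVs, -, hΞd, hΞm, hΞp, hΞbij⟩ :=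
    exists_contDiffOn_frame_along_segment hdimA hU₀ hIU₀ hAd hAinj hbm hbp hdet
  have hΞsm : Ξ (-1) = (fderiv ℝ (ι ∘ (e ∘ Λ₁)) (-1, 0)).comp
      (ContinuousLinearMap.inr ℝ ℝ (EuclideanSpace ℝ (Fin (r - 1)))) := by
    rw [hΞm]; exact ContinuousLinearMap.ext fun w => rfl
  have hΞsp : Ξ 1 = (fderiv ℝ (ι ∘ (e ∘ Λ₁)) (1, 0)).comp
      (ContinuousLinearMap.inr ℝ ℝ (EuclideanSpace ℝ (Fin (r - 1)))) := by
    rw [hΞp]; exact ContinuousLinearMap.ext fun w => rfl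
  have hΞsinj : ∀ x ∈ Icc (-1 : ℝ) 1, Injective
      ((((fderiv ℝ (ι ∘ φ) (x, 0)).coprod (Nf (x, 0))).coprod
        ((fderiv ℝ (ι ∘ (e' ∘ Λ₂)) (x, 0)).comp
          (ContinuousLinearMap.inr ℝ ℝ (EuclideanSpace ℝ (Fin (s - 1)))))).coprod (Ξ x)) := by
    intro x hx
    refine (injective_iff_map_eq_zero _).2 fun q hq => ?_
    obtain ⟨p₀, f⟩ := q
    have h0 : (A x).coprod (Ξ x) (isoA.symm p₀, f) = 0 := by
      rw [ContinuousLinearMap.coprod_apply] at hq ⊢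
      rw [← hq]
      simp only [hA, ContinuousLinearMap.coe_comp, comp_apply, ContinuousLinearEquiv.coe_coe,
        ContinuousLinearEquiv.apply_symm_apply]
    have := (injective_iff_map_eq_zero _).1 (hΞbij x hx).1 _ h0
    simp only [Prod.mk_eq_zero, EmbeddingLike.map_eq_zero_iff] at this
    rw [this.1, this.2]; rfl
  ------------------------------------------------------------------------------------------
  -- Step 6: Lemma 6.13, the frame fields over the disc
  ------------------------------------------------------------------------------------------
  have hfr₁' : ∀ x ∈ Icc (-1 : ℝ) 1, Injective fun w : (ℝ × ℝ) × EuclideanSpace ℝ (Fin (r - 1)) =>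
      fderiv ℝ (ι ∘ φ) (x, x ^ 2 - 1) w.1 + fderiv ℝ (ι ∘ (e ∘ Λ₁)) (x, 0) (0, w.2) :=
    fun x hx => hfr₁ x hx
  obtain ⟨Ξf, Ηf, O, δ, hOo, hDO, hδ, hΞfd, hΗfd, hΞT, hΗT, hΞband, hΗband, hframe⟩ :=
    exists_whitneyDiscFrames hι hιimm hnN hF₁ hF₂ hrs hs hr hφ himmD hm₁ hm₂ hκ harc' hfr₁' hO₀
      hDO₀ hNfd hNf hVs hIVs hΞd hΞsm hΞsp hΞsinj
  ------------------------------------------------------------------------------------------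
  -- Step 7: the thickening of the disc
  ------------------------------------------------------------------------------------------
  have hdimF : finrank ℝ ((ℝ × ℝ) × (EuclideanSpace ℝ (Fin (r - 1)) × EuclideanSpace ℝ (Fin (s - 1))))
      = n := by
    simp only [finrank_prod, finrank_euclideanSpace_fin, Module.finrank_self]; omega
  obtain ⟨Θ, hloc, hΘ0, hΘ1, hΘ2⟩ := exists_whitneyThickening hι hTopen hrT hιT hrι hrN hdimF hφ hm₁
    hm₂ harc' hOo hDO hΞfd hΗfd hΞT hΗT hδ hΞband hΗband hframe
  ------------------------------------------------------------------------------------------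
  -- Step 8: the sheet models
  ------------------------------------------------------------------------------------------
  have hκev₁ : ∀ u ∈ {z : ℝ × ℝ | z.1 ^ 2 - 1 ≤ z.2 ∧ z.2 ≤ 0},
      ∀ᶠ y in 𝓝 ((u.1, 0) : ℝ × EuclideanSpace ℝ (Fin (r - 1))), |y.1| < 1 + κ := by
    intro u hu
    have h1 := hu.1; have h2 := hu.2
    have hxa := abs_le_of_sq_le_sq (show u.1 ^ 2 ≤ 1 ^ 2 by nlinarith) (by norm_num)
    exact (isOpen_lt (continuous_abs.comp continuous_fst) continuous_const).mem_nhds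
      (by show |u.1| < 1 + κ; linarith)
  have hκev₂ : ∀ u ∈ {z : ℝ × ℝ | z.1 ^ 2 - 1 ≤ z.2 ∧ z.2 ≤ 0},
      ∀ᶠ y in 𝓝 ((u.1, 0) : ℝ × EuclideanSpace ℝ (Fin (s - 1))), |y.1| < 1 + κ := by
    intro u hu
    have h1 := hu.1; have h2 := hu.2
    have hxa := abs_le_of_sq_le_sq (show u.1 ^ 2 ≤ 1 ^ 2 by nlinarith) (by norm_num)
    exact (isOpen_lt (continuous_abs.comp continuous_fst) continuous_const).mem_nhds
      (by show |u.1| < 1 + κ; linarith)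
  have hκ1 : |(-1 : ℝ)| < 1 + κ := by simp; linarith
  have hκ1' : |(1 : ℝ)| < 1 + κ := by simp; linarith
  refine ⟨EuclideanSpace ℝ (Fin (r - 1)), inferInstance, inferInstance, inferInstance,
    EuclideanSpace ℝ (Fin (s - 1)), inferInstance, inferInstance, inferInstance, Θ, hF₁, hF₂, hloc,
    ?_, ?_, ?_, ?_, ?_, ?_, ?_⟩
  · -- injective on the disc
    intro u hu u' hu' huu'
    have : φ u = φ u' := by simpa only [hΘ0] using huu'
    exact hinjD hu hu' this
  · -- the sheet through `C` lies in `M`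
    intro u hu _
    filter_upwards [hκev₁ u hu] with y hy
    rw [hΘ1 y.1 hy y.2]
    exact ⟨Λ₁ (y.1, y.2), rfl⟩
  · -- the sheet through `C'` lies in `M'`
    intro u hu _
    filter_upwards [hκev₂ u hu] with y hy
    rw [hΘ2 y.1 hy y.2]
    exact ⟨Λ₂ (y.1, y.2), rfl⟩
  · -- off the parabola the core misses `M`
    intro u hu hne hmem
    rw [hΘ0] at hmem
    exact hne (hoff₁ u hu hmem)
  · -- off the axis the core misses `M'`
    intro u hu hne hmem
    rw [hΘ0] at hmem
    exact hne (hoff₂ u hu hmem)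
  · -- the corner `p`
    rw [hΘ0, (harc (-1) hκ1).2, hΛ₂a]
    exact h₁.symm
  · -- the corner `q`
    rw [hΘ0, (harc 1 hκ1').2, hΛ₂b]
    exact h₂.symm

end Literature.Topology.FourManifolds
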